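import Mathlib
import Literature.Probability.LatticeModels.GKSInequalities
import HarnessLib

/-!
# Crux `PrecisionLaplacian.InverseMFerromagnet` (stmt-CriticalPhenomena-4798), line `Sketch` —
# stub `helper_law2_fourVisible_of` (G3, the glue of the level-4 Gram stubs)

THEOREM-ONLY file (no definitions).  For an `n`-site zero-field pair ferromagnet
(`gksExpect univ K C`, `K ≥ 0`, `|C i| = 2`) and a site embedding `e : Fin 4 ↪ Fin n`, the
MARGINAL WEIGHT of the four visible spins is `ν(s) = ∑_{ω : ω ∘ e = s} gksWeight univ K C ω`.
* G1 (hypothesis `hG1`, stub `helper_law2_four_mtp2`): `Law₂` on `{±1}⁴` for every positive, even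
  weight `ν` with the FKG lattice condition;
* G2 (hypothesis `hG2`, stub `helper_marginal_four_mtp2`): the marginal weight has exactly these
  three properties.
Here (G3) we glue them: every `n`-site expectation of an observable of the visible spins
`ω ∘ e` is the `ν`-average of that observable,
`gksExpect univ K C (f ∘ (· ∘ e)) = (∑_s ν(s) f(s)) / ∑_s ν(s)` (`l4v_gksExpect_marginal`, by
summing over the fibres of `ω ↦ ω ∘ e`), and the integrands `σ_{e(A)}σ_{e w}`, `σ_{e p}σ_{e q}`,
`σ_{e(A)}σ_{e(B)}` are such observables (`Finset.prod_map`); after this rewriting the claim is G1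
for `ν`, whose hypotheses are G2.
-/

namespace Summit.CriticalPhenomena.Ising3DConformalLimit.Cruxes.InverseMFerromagnet.PartialCovarianceLadder

open Literature.Probability.LatticeModels Finset Matrix

/-- `σ_{e(t)}(ω) = σ_t(ω ∘ e)`: a spin product over an embedded set is a function of the visible
spins. [folklore] -/
theorem l4v_spinProduct_map {V W : Type*} (e : V ↪ W) (t : Finset V) (ω : SpinConfig W) :
    spinProduct (t.map e) ω = spinProduct t (fun k => ω (e k)) := by
  rw [spinProduct, spinProduct, Finset.prod_map]
  rfl

/-- **Marginalisation of an unnormalised sum along a site embedding.**  Summing `g(ω ∘ e) w(ω)`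
over all configurations `ω` is summing `ν(s) g(s)` over the visible configurations `s`, where
`ν(s) = ∑_{ω : ω ∘ e = s} w(ω)` is the marginal weight (every `ω` lies in exactly one fibre).
[folklore] -/
theorem l4v_sum_marginal {n : ℕ} (w : SpinConfig (Fin n) → ℝ) (e : Fin 4 ↪ Fin n)
    (ν : SpinConfig (Fin 4) → ℝ)
    (hν : ∀ s, ν s = ∑ ω : SpinConfig (Fin n), if (∀ k, ω (e k) = s k) then w ω else 0)
    (g : SpinConfig (Fin 4) → ℝ) :
    ∑ ω, g (fun k => ω (e k)) * w ω = ∑ s, ν s * g s := by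
  have h : ∀ s, ν s * g s
      = ∑ ω : SpinConfig (Fin n), if (∀ k, ω (e k) = s k) then w ω * g s else 0 := fun s => by
    rw [hν s, Finset.sum_mul]
    exact Finset.sum_congr rfl fun ω _ => by rw [ite_mul, zero_mul]
  simp only [h]
  rw [Finset.sum_comm]
  refine Finset.sum_congr rfl fun ω _ => ?_
  rw [Fintype.sum_eq_single (fun k => ω (e k))]
  · rw [if_pos fun _ => rfl, mul_comm]
  · intro s hs
    exact if_neg fun h => hs (funext fun k => (h k).symm)

/-- **Expectations of visible observables are marginal averages.**  For the marginal weight `ν`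
of the visible spins `ω ∘ e`,
`gksExpect univ K C (fun ω => f (ω ∘ e)) = (∑_s ν(s) f(s)) / ∑_s ν(s)`. [folklore] -/
theorem l4v_gksExpect_marginal {n m : ℕ} (K : Fin m → ℝ) (C : Fin m → Finset (Fin n))
    (e : Fin 4 ↪ Fin n) (ν : SpinConfig (Fin 4) → ℝ)
    (hν : ∀ s, ν s = ∑ ω : SpinConfig (Fin n),
      if (∀ k, ω (e k) = s k) then gksWeight Finset.univ K C ω else 0)
    (f : SpinConfig (Fin 4) → ℝ) :
    gksExpect Finset.univ K C (fun ω => f (fun k => ω (e k))) = (∑ s, ν s * f s) / ∑ s, ν s := by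
  have h1 := l4v_sum_marginal (gksWeight Finset.univ K C) e ν hν f
  have h2 := l4v_sum_marginal (gksWeight Finset.univ K C) e ν hν (fun _ => 1)
  simp only [one_mul, mul_one] at h2
  simp only [gksExpect, gksSum, one_mul]
  rw [h1, h2]

/-- **G3 · `helper_law2_fourVisible_of` — glue: `Law₂` for triples inside a 4-set of VISIBLE sites of an `n`-site
pair ferromagnet, conditioning on the linear span of those four spins only, from G1 and G2.**  Route: every
`n`-site expectation of a function of the visible spins `σ ∘ e` is the `ν`-expectation of that function
(`gksExpect univ K C (f ∘ (· ∘ e)) = (∑ ν f)/(∑ ν)` with `ν` the marginal weight of G2), then G1. [folklore] -/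
theorem helper_law2_fourVisible_of
    (hG1 : ∀ (ν : SpinConfig (Fin 4) → ℝ), (∀ ω, 0 < ν ω) → (∀ ω, ν (-ω) = ν ω) →
      (∀ ω ω', ν ω * ν ω' ≤ ν (ω ⊓ ω') * ν (ω ⊔ ω')) →
      ∀ (A B : Finset (Fin 4)), A.card = 3 → B.card = 3 →
        dotProduct (fun w => (∑ ω, ν ω * (spinProduct A ω * spinAt w ω)) / ∑ ω, ν ω)
          (((Matrix.of fun p q : Fin 4 => (∑ ω, ν ω * (spinAt p ω * spinAt q ω)) / ∑ ω, ν ω)⁻¹).mulVec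
            (fun w => (∑ ω, ν ω * (spinProduct B ω * spinAt w ω)) / ∑ ω, ν ω))
        ≤ (∑ ω, ν ω * (spinProduct A ω * spinProduct B ω)) / ∑ ω, ν ω)
    (hG2 : ∀ (n m : ℕ) (K : Fin m → ℝ) (C : Fin m → Finset (Fin n)), (∀ i, 0 ≤ K i) → (∀ i, (C i).card = 2) →
      ∀ (e : Fin 4 ↪ Fin n) (ν : SpinConfig (Fin 4) → ℝ),
        (∀ s, ν s = ∑ ω : SpinConfig (Fin n), if (∀ k, ω (e k) = s k) then gksWeight Finset.univ K C ω else 0) →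
        (∀ s, 0 < ν s) ∧ (∀ s, ν (-s) = ν s) ∧ (∀ s s', ν s * ν s' ≤ ν (s ⊓ s') * ν (s ⊔ s'))) :
    ∀ (n m : ℕ) (K : Fin m → ℝ) (C : Fin m → Finset (Fin n)), (∀ i, 0 ≤ K i) → (∀ i, (C i).card = 2) →
      ∀ (e : Fin 4 ↪ Fin n) (A B : Finset (Fin 4)), A.card = 3 → B.card = 3 →
        dotProduct (fun w => gksExpect Finset.univ K C (fun ω => spinProduct (A.map e) ω * spinAt (e w) ω))
          (((Matrix.of fun p q : Fin 4 =>
              gksExpect Finset.univ K C (fun ω => spinAt (e p) ω * spinAt (e q) ω))⁻¹).mulVec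
            (fun w => gksExpect Finset.univ K C (fun ω => spinProduct (B.map e) ω * spinAt (e w) ω)))
        ≤ gksExpect Finset.univ K C (fun ω => spinProduct (A.map e) ω * spinProduct (B.map e) ω) := by
  intro n m K C hK hC e A B hA hB
  -- the marginal weight of the four visible spins (kept opaque through its defining equation)
  obtain ⟨ν, hν⟩ : ∃ ν : SpinConfig (Fin 4) → ℝ, ∀ s, ν s = ∑ ω : SpinConfig (Fin n),
      if (∀ k, ω (e k) = s k) then gksWeight Finset.univ K C ω else 0 := ⟨_, fun _ => rfl⟩
  obtain ⟨hpos, heven, hlat⟩ := hG2 n m K C hK hC e ν hν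
  have key : ∀ f : SpinConfig (Fin 4) → ℝ,
      gksExpect Finset.univ K C (fun ω => f (fun k => ω (e k))) = (∑ s, ν s * f s) / ∑ s, ν s :=
    fun f => l4v_gksExpect_marginal K C e ν hν f
  -- the three kinds of integrands are observables of the visible spins
  have hvec : ∀ (T : Finset (Fin 4)) (w : Fin 4),
      gksExpect Finset.univ K C (fun ω => spinProduct (T.map e) ω * spinAt (e w) ω)
        = (∑ s, ν s * (spinProduct T s * spinAt w s)) / ∑ s, ν s := fun T w =>
    (congrArg (gksExpect Finset.univ K C)
      (funext fun ω => by rw [l4v_spinProduct_map]; rfl)).trans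
      (key fun s => spinProduct T s * spinAt w s)
  have hmat : ∀ p q : Fin 4,
      gksExpect Finset.univ K C (fun ω => spinAt (e p) ω * spinAt (e q) ω)
        = (∑ s, ν s * (spinAt p s * spinAt q s)) / ∑ s, ν s := fun p q =>
    key fun s => spinAt p s * spinAt q s
  have hAB : gksExpect Finset.univ K C (fun ω => spinProduct (A.map e) ω * spinProduct (B.map e) ω)
      = (∑ s, ν s * (spinProduct A s * spinProduct B s)) / ∑ s, ν s :=
    (congrArg (gksExpect Finset.univ K C)
      (funext fun ω => by rw [l4v_spinProduct_map, l4v_spinProduct_map])).trans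
      (key fun s => spinProduct A s * spinProduct B s)
  simp only [hvec, hmat, hAB]
  exact hG1 ν hpos heven hlat A B hA hB

end Summit.CriticalPhenomena.Ising3DConformalLimit.Cruxes.InverseMFerromagnet.PartialCovarianceLadder
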